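import Mathlib

/-!
# PercRepro — S2: CLOSED-FORM BOUNDS FOR THE FIBRE-WEIGHT SUMS OF THE CUBIC AND QUARTIC MULTIPLICITIES
(p4, gen 17; a feeder for the S4 rows `q ≥ 10` (owner p9): the «saturated weights» `W·μ ≤ 2^μ` of THEOREM P⁗″'s chain
come from the linear multiplicity `Σ_{j} C(μ − 1, j)/(j + 1) ≤ 2^μ/μ`; with the cubic multiplicity
`cube(ν) = ν + 3·C(ν, 2) + 3·C(ν, 3)` the same sum is `≤ 24·2^μ/(μ(μ + 1)(μ + 2))`, with the quartic
`quart(ν) = cube(ν) + 2·C(ν, 4)` it is `≤ 192·2^μ/(μ(μ + 1)(μ + 2)(μ + 3))` — here with `μ = F + 1`.)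

The mechanism: `C(j + 3, 3) ≤ cube(j + 1)` and `C(j + 4, 4) ≤ quart(j + 1)` (Pascal's rule expanded), and
`C(F, j)/C(j + 3, 3) = C(F + 3, j + 3)/C(F + 3, 3)` (`Nat.choose_mul`), so the sum is `≤ 2^{F+3}/C(F + 3, 3)`;
`6·C(F + 3, 3) = (F + 1)(F + 2)(F + 3)`. Pricing (mining/p4/g17/keyp/): p9's KeyP floors `p₀(q)` at
`q = 10 … 16` would fall from `8 710 / 18 780 / 40 117 / 85 547 / 180 954 / 382 950 / 807 303` to
`3 294 / 6 833 / 14 148 / 29 368 / 60 745 / 126 016 / 261 099` (cube) and `2 126 / 4 309 / 8 751 / 17 867 /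
36 448 / 74 689 / 153 107` (quart). Axioms: standard.
-/

namespace PercRepro

namespace S2

/-- `∑_{k < K} C(n, k) ≤ 2^n` for every `K`. -/
theorem sum_range_choose_le (n K : ℕ) : ∑ k ∈ Finset.range K, n.choose k ≤ 2 ^ n := by
  rcases Nat.lt_or_ge (n + 1) K with h | h
  · rw [← Finset.sum_range_add_sum_Ico _ h.le, Nat.sum_range_choose]
    have h0 : ∑ k ∈ Finset.Ico (n + 1) K, n.choose k = 0 :=
      Finset.sum_eq_zero (fun k hk => Nat.choose_eq_zero_of_lt (by have := (Finset.mem_Ico.1 hk).1; omega))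
    rw [h0, add_zero]
  · calc ∑ k ∈ Finset.range K, n.choose k ≤ ∑ k ∈ Finset.range (n + 1), n.choose k :=
        Finset.sum_le_sum_of_subset_of_nonneg (Finset.range_subset_range.2 h) (fun _ _ _ => Nat.zero_le _)
      _ = 2 ^ n := Nat.sum_range_choose n

/-- `∑_{j < N} C(n, j + s) ≤ 2^n`. -/
theorem sum_range_choose_add_le (n N s : ℕ) : ∑ j ∈ Finset.range N, n.choose (j + s) ≤ 2 ^ n := by
  have h1 : ∑ j ∈ Finset.range N, n.choose (j + s) = ∑ k ∈ Finset.Ico s (N + s), n.choose k := by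
    rw [Finset.sum_Ico_eq_sum_range, show N + s - s = N by omega]
    apply Finset.sum_congr rfl
    intro j _
    rw [add_comm s j]
  rw [h1]
  calc ∑ k ∈ Finset.Ico s (N + s), n.choose k ≤ ∑ k ∈ Finset.range (N + s), n.choose k :=
      Finset.sum_le_sum_of_subset_of_nonneg (fun k hk => Finset.mem_range.2 (Finset.mem_Ico.1 hk).2)
        (fun _ _ _ => Nat.zero_le _)
    _ ≤ 2 ^ n := sum_range_choose_le n (N + s)

/-- `C(j + 3, 3) ≤ cube(j + 1) = (j + 1) + 3·C(j + 1, 2) + 3·C(j + 1, 3)` (Pascal's rule twice: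
`C(j + 3, 3) = C(j + 1, 1) + 2·C(j + 1, 2) + C(j + 1, 3)`). -/
theorem choose_add_three_le_cube (j : ℕ) :
    (j + 3).choose 3 ≤ (j + 1) + 3 * (j + 1).choose 2 + 3 * (j + 1).choose 3 := by
  have h1 : (j + 3).choose 3 = (j + 2).choose 2 + (j + 2).choose 3 := Nat.choose_succ_succ' (j + 2) 2
  have h2 : (j + 2).choose 2 = (j + 1).choose 1 + (j + 1).choose 2 := Nat.choose_succ_succ' (j + 1) 1
  have h3 : (j + 2).choose 3 = (j + 1).choose 2 + (j + 1).choose 3 := Nat.choose_succ_succ' (j + 1) 2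
  rw [Nat.choose_one_right] at h2
  omega

/-- `C(j + 4, 4) ≤ quart(j + 1) = (j + 1) + 3·C(j + 1, 2) + 3·C(j + 1, 3) + 2·C(j + 1, 4)` (Pascal's rule:
`C(j + 4, 4) = C(j + 1, 1) + 3·C(j + 1, 2) + 3·C(j + 1, 3) + C(j + 1, 4)`). -/
theorem choose_add_four_le_quart (j : ℕ) :
    (j + 4).choose 4 ≤ (j + 1) + 3 * (j + 1).choose 2 + 3 * (j + 1).choose 3 + 2 * (j + 1).choose 4 := by
  have h1 : (j + 4).choose 4 = (j + 3).choose 3 + (j + 3).choose 4 := Nat.choose_succ_succ' (j + 3) 3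
  have h2 : (j + 3).choose 3 = (j + 2).choose 2 + (j + 2).choose 3 := Nat.choose_succ_succ' (j + 2) 2
  have h3 : (j + 3).choose 4 = (j + 2).choose 3 + (j + 2).choose 4 := Nat.choose_succ_succ' (j + 2) 3
  have h4 : (j + 2).choose 2 = (j + 1).choose 1 + (j + 1).choose 2 := Nat.choose_succ_succ' (j + 1) 1
  have h5 : (j + 2).choose 3 = (j + 1).choose 2 + (j + 1).choose 3 := Nat.choose_succ_succ' (j + 1) 2
  have h6 : (j + 2).choose 4 = (j + 1).choose 3 + (j + 1).choose 4 := Nat.choose_succ_succ' (j + 1) 3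
  rw [Nat.choose_one_right] at h4
  omega

/-- `C(F, j) · C(F + s, s) = C(F + s, j + s) · C(j + s, s)` (choose the `s`-subset first or the `(j+s)`-subset first). -/
theorem choose_mul_choose_add (F j s : ℕ) :
    F.choose j * (F + s).choose s = (F + s).choose (j + s) * (j + s).choose s := by
  have h := Nat.choose_mul (n := F + s) (k := j + s) (s := s) (by omega)
  rw [show F + s - s = F by omega, show j + s - s = j by omega] at h
  rw [h, mul_comm]

/-- `s! · C(n + s, s) = (n + 1) ⋯ (n + s)`, for `s = 3`: `6 · C(F + 3, 3) = (F + 1)(F + 2)(F + 3)`. -/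
theorem six_mul_choose_add_three (F : ℕ) : 6 * (F + 3).choose 3 = (F + 1) * (F + 2) * (F + 3) := by
  have h := Nat.choose_mul_factorial_mul_factorial (show 3 ≤ F + 3 by omega)
  rw [show F + 3 - 3 = F by omega] at h
  have hpos := Nat.factorial_pos F
  apply Nat.eq_of_mul_eq_mul_right hpos
  calc 6 * (F + 3).choose 3 * F.factorial = (F + 3).choose 3 * Nat.factorial 3 * F.factorial := by
        rw [show Nat.factorial 3 = 6 from rfl]; ring
    _ = (F + 3).factorial := h
    _ = (F + 1) * (F + 2) * (F + 3) * F.factorial := by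
        rw [Nat.factorial_succ, Nat.factorial_succ, Nat.factorial_succ]; ring

/-- `24 · C(F + 4, 4) = (F + 1)(F + 2)(F + 3)(F + 4)`. -/
theorem twentyfour_mul_choose_add_four (F : ℕ) :
    24 * (F + 4).choose 4 = (F + 1) * (F + 2) * (F + 3) * (F + 4) := by
  have h := Nat.choose_mul_factorial_mul_factorial (show 4 ≤ F + 4 by omega)
  rw [show F + 4 - 4 = F by omega] at h
  have hpos := Nat.factorial_pos F
  apply Nat.eq_of_mul_eq_mul_right hpos
  calc 24 * (F + 4).choose 4 * F.factorial = (F + 4).choose 4 * Nat.factorial 4 * F.factorial := by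
        rw [show Nat.factorial 4 = 24 from rfl]; ring
    _ = (F + 4).factorial := h
    _ = (F + 1) * (F + 2) * (F + 3) * (F + 4) * F.factorial := by
        rw [Nat.factorial_succ, Nat.factorial_succ, Nat.factorial_succ, Nat.factorial_succ]; ring

/-- **THE CUBIC WEIGHT SUM**: `∑_{j < N} C(F, j)/cube(j + 1) ≤ 2^{F+3}/C(F + 3, 3)` (every `N`). -/
theorem sum_range_choose_div_cube_le' (F N : ℕ) :
    ∑ j ∈ Finset.range N, (F.choose j : ℚ) / (((j + 1) + 3 * (j + 1).choose 2 + 3 * (j + 1).choose 3 : ℕ) : ℚ) ≤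
      2 ^ (F + 3) / ((F + 3).choose 3 : ℚ) := by
  have hC3 : (0 : ℚ) < ((F + 3).choose 3 : ℚ) := by exact_mod_cast Nat.choose_pos (by omega : 3 ≤ F + 3)
  have hterm : ∀ j ∈ Finset.range N,
      (F.choose j : ℚ) / (((j + 1) + 3 * (j + 1).choose 2 + 3 * (j + 1).choose 3 : ℕ) : ℚ) ≤
        ((F + 3).choose (j + 3) : ℚ) / ((F + 3).choose 3 : ℚ) := by
    intro j _
    have hc3 : (0 : ℚ) < ((j + 3).choose 3 : ℚ) := by exact_mod_cast Nat.choose_pos (by omega : 3 ≤ j + 3)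
    have hcube : ((j + 3).choose 3 : ℚ) ≤ (((j + 1) + 3 * (j + 1).choose 2 + 3 * (j + 1).choose 3 : ℕ) : ℚ) := by
      exact_mod_cast choose_add_three_le_cube j
    calc (F.choose j : ℚ) / (((j + 1) + 3 * (j + 1).choose 2 + 3 * (j + 1).choose 3 : ℕ) : ℚ)
        ≤ (F.choose j : ℚ) / ((j + 3).choose 3 : ℚ) :=
          div_le_div_of_nonneg_left (Nat.cast_nonneg _) hc3 hcube
      _ = ((F + 3).choose (j + 3) : ℚ) / ((F + 3).choose 3 : ℚ) := by
          rw [div_eq_div_iff hc3.ne' hC3.ne']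
          exact_mod_cast choose_mul_choose_add F j 3
  calc ∑ j ∈ Finset.range N, (F.choose j : ℚ) / (((j + 1) + 3 * (j + 1).choose 2 + 3 * (j + 1).choose 3 : ℕ) : ℚ)
      ≤ ∑ j ∈ Finset.range N, ((F + 3).choose (j + 3) : ℚ) / ((F + 3).choose 3 : ℚ) := Finset.sum_le_sum hterm
    _ = (∑ j ∈ Finset.range N, ((F + 3).choose (j + 3) : ℚ)) / ((F + 3).choose 3 : ℚ) := by
        rw [Finset.sum_div]
    _ ≤ 2 ^ (F + 3) / ((F + 3).choose 3 : ℚ) := by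
        apply div_le_div_of_nonneg_right _ hC3.le
        exact_mod_cast sum_range_choose_add_le (F + 3) N 3

/-- **THE CUBIC WEIGHT SUM, CLOSED FORM**: `∑_{j < N} C(F, j)/cube(j + 1) ≤ 24·2^{F+1}/((F + 1)(F + 2)(F + 3))`
(the linear weight of THEOREM P⁗″ is `2^{F+1}/(F + 1)`). -/
theorem sum_range_choose_div_cube_le (F N : ℕ) :
    ∑ j ∈ Finset.range N, (F.choose j : ℚ) / (((j + 1) + 3 * (j + 1).choose 2 + 3 * (j + 1).choose 3 : ℕ) : ℚ) ≤
      24 * 2 ^ (F + 1) / (((F + 1) * (F + 2) * (F + 3) : ℕ) : ℚ) := by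
  refine (sum_range_choose_div_cube_le' F N).trans (le_of_eq ?_)
  have h := six_mul_choose_add_three F
  have hC3 : (0 : ℚ) < ((F + 3).choose 3 : ℚ) := by exact_mod_cast Nat.choose_pos (by omega : 3 ≤ F + 3)
  have hP : (0 : ℚ) < (((F + 1) * (F + 2) * (F + 3) : ℕ) : ℚ) := by positivity
  rw [div_eq_div_iff hC3.ne' hP.ne']
  have h' : (((F + 1) * (F + 2) * (F + 3) : ℕ) : ℚ) = 6 * ((F + 3).choose 3 : ℚ) := by exact_mod_cast h.symm
  rw [h']
  ring

/-- **THE QUARTIC WEIGHT SUM**: `∑_{j < N} C(F, j)/quart(j + 1) ≤ 2^{F+4}/C(F + 4, 4)`. -/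
theorem sum_range_choose_div_quart_le' (F N : ℕ) :
    ∑ j ∈ Finset.range N, (F.choose j : ℚ) /
        (((j + 1) + 3 * (j + 1).choose 2 + 3 * (j + 1).choose 3 + 2 * (j + 1).choose 4 : ℕ) : ℚ) ≤
      2 ^ (F + 4) / ((F + 4).choose 4 : ℚ) := by
  have hC4 : (0 : ℚ) < ((F + 4).choose 4 : ℚ) := by exact_mod_cast Nat.choose_pos (by omega : 4 ≤ F + 4)
  have hterm : ∀ j ∈ Finset.range N,
      (F.choose j : ℚ) / (((j + 1) + 3 * (j + 1).choose 2 + 3 * (j + 1).choose 3 + 2 * (j + 1).choose 4 : ℕ) : ℚ) ≤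
        ((F + 4).choose (j + 4) : ℚ) / ((F + 4).choose 4 : ℚ) := by
    intro j _
    have hc4 : (0 : ℚ) < ((j + 4).choose 4 : ℚ) := by exact_mod_cast Nat.choose_pos (by omega : 4 ≤ j + 4)
    have hquart : ((j + 4).choose 4 : ℚ) ≤
        (((j + 1) + 3 * (j + 1).choose 2 + 3 * (j + 1).choose 3 + 2 * (j + 1).choose 4 : ℕ) : ℚ) := by
      exact_mod_cast choose_add_four_le_quart j
    calc (F.choose j : ℚ) / (((j + 1) + 3 * (j + 1).choose 2 + 3 * (j + 1).choose 3 + 2 * (j + 1).choose 4 : ℕ) : ℚ)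
        ≤ (F.choose j : ℚ) / ((j + 4).choose 4 : ℚ) :=
          div_le_div_of_nonneg_left (Nat.cast_nonneg _) hc4 hquart
      _ = ((F + 4).choose (j + 4) : ℚ) / ((F + 4).choose 4 : ℚ) := by
          rw [div_eq_div_iff hc4.ne' hC4.ne']
          exact_mod_cast choose_mul_choose_add F j 4
  calc ∑ j ∈ Finset.range N, (F.choose j : ℚ) /
        (((j + 1) + 3 * (j + 1).choose 2 + 3 * (j + 1).choose 3 + 2 * (j + 1).choose 4 : ℕ) : ℚ)
      ≤ ∑ j ∈ Finset.range N, ((F + 4).choose (j + 4) : ℚ) / ((F + 4).choose 4 : ℚ) := Finset.sum_le_sum hterm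
    _ = (∑ j ∈ Finset.range N, ((F + 4).choose (j + 4) : ℚ)) / ((F + 4).choose 4 : ℚ) := by
        rw [Finset.sum_div]
    _ ≤ 2 ^ (F + 4) / ((F + 4).choose 4 : ℚ) := by
        apply div_le_div_of_nonneg_right _ hC4.le
        exact_mod_cast sum_range_choose_add_le (F + 4) N 4

/-- **THE QUARTIC WEIGHT SUM, CLOSED FORM**:
`∑_{j < N} C(F, j)/quart(j + 1) ≤ 192·2^{F+1}/((F + 1)(F + 2)(F + 3)(F + 4))`. -/
theorem sum_range_choose_div_quart_le (F N : ℕ) :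
    ∑ j ∈ Finset.range N, (F.choose j : ℚ) /
        (((j + 1) + 3 * (j + 1).choose 2 + 3 * (j + 1).choose 3 + 2 * (j + 1).choose 4 : ℕ) : ℚ) ≤
      192 * 2 ^ (F + 1) / (((F + 1) * (F + 2) * (F + 3) * (F + 4) : ℕ) : ℚ) := by
  refine (sum_range_choose_div_quart_le' F N).trans (le_of_eq ?_)
  have h := twentyfour_mul_choose_add_four F
  have hC4 : (0 : ℚ) < ((F + 4).choose 4 : ℚ) := by exact_mod_cast Nat.choose_pos (by omega : 4 ≤ F + 4)
  have hP : (0 : ℚ) < (((F + 1) * (F + 2) * (F + 3) * (F + 4) : ℕ) : ℚ) := by positivity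
  rw [div_eq_div_iff hC4.ne' hP.ne']
  have h' : (((F + 1) * (F + 2) * (F + 3) * (F + 4) : ℕ) : ℚ) = 24 * ((F + 4).choose 4 : ℚ) := by
    exact_mod_cast h.symm
  rw [h']
  ring

end S2

end PercRepro
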